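import Summits.Ventures.CertifiedManyBodySolver.Theses.R2cOpenStripTangentLine

/-!
# Candidate proof (planner's SKETCH, attached as item evidence — a PROVER files it under `Theorems/`) of the route ASSEMBLY item
`Assembly` (stmt-Ventures-19264) of route `R2cOpenStripTangentLine`: it is the curried form of the gate-written deciding theorem
`closes`. HONEST FRAMING: first certified bounds; not a superconductivity verdict; every number certified or labelled float.
-/

namespace Summit.Ventures.CertifiedManyBodySolver.Theorems

open Summit.Ventures.CertifiedManyBodySolver.Theses.R2cOpenStripTangentLine

/-- The assembly item (stmt-Ventures-19264) is a free closure of the route's deciding theorem `closes`. -/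
theorem r2cAssembly_proof : Assembly := fun h₂ h₃ => closes h₂ h₃

end Summit.Ventures.CertifiedManyBodySolver.Theorems
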